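import Mathlib
import Summits.Ventures.PercRepro2.RootPairSepCut

/-!
# Pendant pieces for the TYPED bracket β₁ = (HALF-PM⁺)_L + (HALF-PM⁺)_H + A
(blind cell PercRepro2, mine-2 g21; proofs/MINE2-CUTU.md §10.5; the weighted L-half versions are in
`RootPairSepPendant.lean`, the structural lemmas and `prob_pendant_mul` in `RootPairSepCut.lean`).

With `c` a cut vertex (`IsRootPairSep ends c c V₁ V₂`), both roots in `V₁` and `γ_v = {v ↔ c inside V₂}`:
a pendant `b` gives `β₁(o, u, b) = P(γ_b) · β₁(o, u, c)` (`beta1_pendant_b`) and a pendant `o` gives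
`β₁(o, u, b) = P(γ_o) · β₁(c, u, b)` (`beta1_pendant_o`); the factorisation of `oU ∩ Y` is
`prob_pendant_union_mul`.  The pendant `u` is in `RootPairSepTypedPendantU.lean`.
-/

namespace Summit.Ventures.PercRepro2

namespace RootPairSep

open SepPair

section Main

variable {V : Type*} {E : Type*} [Fintype E] [DecidableEq E] {R : Type*} [CommRing R]

/-- Both root connections of a pendant mark `v` pass through `c`:
`P(vU ∩ Y) = P(γ_v) · P(cU ∩ Y)` for `Y` determined by the edges of `V₁`. -/
theorem prob_pendant_union_mul (p : E → R) {ends : E → Sym2 V} {c a₁ a₂ : V} {V₁ V₂ : Set V}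
    (hs : IsRootPairSep ends c c V₁ V₂) [DecidablePred (· ∈ side₁ ends V₁)]
    [DecidablePred (· ∈ (side₁ ends V₁)ᶜ)] (ha₁ : a₁ ∈ V₁) (ha₂ : a₂ ∈ V₁) {v : V} (hv : v ∈ V₂)
    {Y : Set (Config E)} (hY : ∀ ω, ω ∈ Y ↔ restrictTo (side₁ ends V₁) ω ∈ Y) :
    prob p ((connEvent ends a₁ v ∪ connEvent ends a₂ v) ∩ Y) =
      prob p (restrictTo (side₁ ends V₁)ᶜ ⁻¹' connEvent ends v c) *
        prob p ((connEvent ends a₁ c ∪ connEvent ends a₂ c) ∩ Y) := by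
  have hc₁ : c ∈ V₁ := hs.a₁_mem.1
  have ind : ∀ A B : Set (Config E),
      prob p (restrictTo (side₁ ends V₁)ᶜ ⁻¹' A ∩ restrictTo (side₁ ends V₁) ⁻¹' B) =
        prob p (restrictTo (side₁ ends V₁)ᶜ ⁻¹' A) * prob p (restrictTo (side₁ ends V₁) ⁻¹' B) :=
    fun A B => prob_inter_eq_mul_of_dependsOn p disjoint_compl_left
      (dependsOn_restrictTo _ A) (dependsOn_restrictTo _ B)
  have e : (connEvent ends a₁ v ∪ connEvent ends a₂ v) ∩ Y =
      restrictTo (side₁ ends V₁)ᶜ ⁻¹' connEvent ends v c ∩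
        restrictTo (side₁ ends V₁) ⁻¹' ((connEvent ends a₁ c ∪ connEvent ends a₂ c) ∩ Y) := by
    ext ω
    have h2 := conn_cut hs (ω := ω) hv ha₁
    have h2' := conn_cut hs (ω := ω) hv ha₂
    have h5 := hY ω
    simp only [Set.mem_inter_iff, Set.mem_union, Set.mem_preimage]
    change ((Conn ends ω a₁ v ∨ Conn ends ω a₂ v) ∧ ω ∈ Y) ↔
      Conn ends (restrictTo (side₁ ends V₁)ᶜ ω) v c ∧
        ((Conn ends (restrictTo (side₁ ends V₁) ω) a₁ c ∨
          Conn ends (restrictTo (side₁ ends V₁) ω) a₂ c) ∧ restrictTo (side₁ ends V₁) ω ∈ Y)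
    constructor
    · rintro ⟨h | h, hy⟩
      · obtain ⟨hc, hca⟩ := h2.1 (conn_symm h)
        exact ⟨hc, Or.inl (conn_symm hca), h5.1 hy⟩
      · obtain ⟨hc, hca⟩ := h2'.1 (conn_symm h)
        exact ⟨hc, Or.inr (conn_symm hca), h5.1 hy⟩
    · rintro ⟨hc, h | h, hy⟩
      · exact ⟨Or.inl (conn_symm (h2.2 ⟨hc, conn_symm h⟩)), h5.2 hy⟩
      · exact ⟨Or.inr (conn_symm (h2'.2 ⟨hc, conn_symm h⟩)), h5.2 hy⟩
  have e' : (connEvent ends a₁ c ∪ connEvent ends a₂ c) ∩ Y =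
      restrictTo (side₁ ends V₁) ⁻¹' ((connEvent ends a₁ c ∪ connEvent ends a₂ c) ∩ Y) := by
    ext ω
    have h4 := conn_detour hs (ω := ω) ha₁ hc₁
    have h4' := conn_detour hs (ω := ω) ha₂ hc₁
    have h5 := hY ω
    simp only [Set.mem_inter_iff, Set.mem_union, Set.mem_preimage]
    change ((Conn ends ω a₁ c ∨ Conn ends ω a₂ c) ∧ ω ∈ Y) ↔
      ((Conn ends (restrictTo (side₁ ends V₁) ω) a₁ c ∨
        Conn ends (restrictTo (side₁ ends V₁) ω) a₂ c) ∧ restrictTo (side₁ ends V₁) ω ∈ Y)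
    constructor
    · rintro ⟨h | h, hy⟩
      · exact ⟨Or.inl (h4.1 h), h5.1 hy⟩
      · exact ⟨Or.inr (h4'.1 h), h5.1 hy⟩
    · rintro ⟨h | h, hy⟩
      · exact ⟨Or.inl (h4.2 h), h5.2 hy⟩
      · exact ⟨Or.inr (h4'.2 h), h5.2 hy⟩
  rw [e, ind, ← e']

/-- **Pendant `b`, typed.**  `β₁(o, u, b) = P(γ_b) · β₁(o, u, c)`. -/
theorem beta1_pendant_b (p : E → R) {ends : E → Sym2 V} {c a₁ a₂ : V} {V₁ V₂ : Set V}
    (hs : IsRootPairSep ends c c V₁ V₂) [DecidablePred (· ∈ side₁ ends V₁)]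
    [DecidablePred (· ∈ (side₁ ends V₁)ᶜ)] (ha₁ : a₁ ∈ V₁) (ha₂ : a₂ ∈ V₁) {o u b : V}
    (ho : o ∈ V₁) (hu : u ∈ V₁) (hb : b ∈ V₂) :
    prob p (connEvent ends a₁ a₂)ᶜ *
          (prob p (connEvent ends a₁ a₂)ᶜ * prob p (connEvent ends a₁ b ∩ connEvent ends a₂ u ∩ (connEvent ends a₁ o ∪ connEvent ends a₂ o) ∩ (connEvent ends a₁ a₂)ᶜ) -
            prob p (connEvent ends a₁ b ∩ (connEvent ends a₁ a₂)ᶜ) * prob p (connEvent ends a₂ u ∩ (connEvent ends a₁ o ∪ connEvent ends a₂ o) ∩ (connEvent ends a₁ a₂)ᶜ)) -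
        prob p ((connEvent ends a₁ o ∪ connEvent ends a₂ o) ∩ (connEvent ends a₁ a₂)ᶜ) *
          (prob p (connEvent ends a₁ a₂)ᶜ * prob p (connEvent ends a₁ b ∩ connEvent ends a₂ u ∩ (connEvent ends a₁ a₂)ᶜ) -
            prob p (connEvent ends a₁ b ∩ (connEvent ends a₁ a₂)ᶜ) * prob p (connEvent ends a₂ u ∩ (connEvent ends a₁ a₂)ᶜ)) -
        prob p (connEvent ends a₁ a₂)ᶜ *
          (prob p (connEvent ends a₁ a₂)ᶜ * prob p (connEvent ends a₁ b ∩ connEvent ends a₂ o ∩ (connEvent ends a₁ a₂)ᶜ) -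
            prob p (connEvent ends a₁ b ∩ (connEvent ends a₁ a₂)ᶜ) * prob p (connEvent ends a₂ o ∩ (connEvent ends a₁ a₂)ᶜ)) +
        prob p (connEvent ends a₁ a₂)ᶜ *
          (prob p (connEvent ends a₁ a₂)ᶜ * prob p (connEvent ends a₂ b ∩ connEvent ends a₁ u ∩ (connEvent ends a₁ o ∪ connEvent ends a₂ o) ∩ (connEvent ends a₁ a₂)ᶜ) -
            prob p (connEvent ends a₂ b ∩ (connEvent ends a₁ a₂)ᶜ) * prob p (connEvent ends a₁ u ∩ (connEvent ends a₁ o ∪ connEvent ends a₂ o) ∩ (connEvent ends a₁ a₂)ᶜ)) -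
        prob p ((connEvent ends a₁ o ∪ connEvent ends a₂ o) ∩ (connEvent ends a₁ a₂)ᶜ) *
          (prob p (connEvent ends a₁ a₂)ᶜ * prob p (connEvent ends a₂ b ∩ connEvent ends a₁ u ∩ (connEvent ends a₁ a₂)ᶜ) -
            prob p (connEvent ends a₂ b ∩ (connEvent ends a₁ a₂)ᶜ) * prob p (connEvent ends a₁ u ∩ (connEvent ends a₁ a₂)ᶜ)) -
        prob p (connEvent ends a₁ a₂)ᶜ *
          (prob p (connEvent ends a₁ a₂)ᶜ * prob p (connEvent ends a₂ b ∩ connEvent ends a₁ o ∩ (connEvent ends a₁ a₂)ᶜ) -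
            prob p (connEvent ends a₂ b ∩ (connEvent ends a₁ a₂)ᶜ) * prob p (connEvent ends a₁ o ∩ (connEvent ends a₁ a₂)ᶜ)) +
        (prob p ((connEvent ends a₁ u ∪ connEvent ends a₂ u) ∩ (connEvent ends a₁ a₂)ᶜ) - prob p (connEvent ends a₁ a₂)ᶜ) *
          (prob p (connEvent ends a₁ a₂)ᶜ * prob p (connEvent ends a₁ b ∩ connEvent ends a₂ o ∩ (connEvent ends a₁ a₂)ᶜ) - prob p (connEvent ends a₁ b ∩ (connEvent ends a₁ a₂)ᶜ) * prob p (connEvent ends a₂ o ∩ (connEvent ends a₁ a₂)ᶜ) +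
            prob p (connEvent ends a₁ a₂)ᶜ * prob p (connEvent ends a₂ b ∩ connEvent ends a₁ o ∩ (connEvent ends a₁ a₂)ᶜ) - prob p (connEvent ends a₂ b ∩ (connEvent ends a₁ a₂)ᶜ) * prob p (connEvent ends a₁ o ∩ (connEvent ends a₁ a₂)ᶜ)) =
      prob p (restrictTo (side₁ ends V₁)ᶜ ⁻¹' connEvent ends b c) *
       (        prob p (connEvent ends a₁ a₂)ᶜ *
              (prob p (connEvent ends a₁ a₂)ᶜ * prob p (connEvent ends a₁ c ∩ connEvent ends a₂ u ∩ (connEvent ends a₁ o ∪ connEvent ends a₂ o) ∩ (connEvent ends a₁ a₂)ᶜ) -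
                prob p (connEvent ends a₁ c ∩ (connEvent ends a₁ a₂)ᶜ) * prob p (connEvent ends a₂ u ∩ (connEvent ends a₁ o ∪ connEvent ends a₂ o) ∩ (connEvent ends a₁ a₂)ᶜ)) -
            prob p ((connEvent ends a₁ o ∪ connEvent ends a₂ o) ∩ (connEvent ends a₁ a₂)ᶜ) *
              (prob p (connEvent ends a₁ a₂)ᶜ * prob p (connEvent ends a₁ c ∩ connEvent ends a₂ u ∩ (connEvent ends a₁ a₂)ᶜ) -
                prob p (connEvent ends a₁ c ∩ (connEvent ends a₁ a₂)ᶜ) * prob p (connEvent ends a₂ u ∩ (connEvent ends a₁ a₂)ᶜ)) -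
            prob p (connEvent ends a₁ a₂)ᶜ *
              (prob p (connEvent ends a₁ a₂)ᶜ * prob p (connEvent ends a₁ c ∩ connEvent ends a₂ o ∩ (connEvent ends a₁ a₂)ᶜ) -
                prob p (connEvent ends a₁ c ∩ (connEvent ends a₁ a₂)ᶜ) * prob p (connEvent ends a₂ o ∩ (connEvent ends a₁ a₂)ᶜ)) +
            prob p (connEvent ends a₁ a₂)ᶜ *
              (prob p (connEvent ends a₁ a₂)ᶜ * prob p (connEvent ends a₂ c ∩ connEvent ends a₁ u ∩ (connEvent ends a₁ o ∪ connEvent ends a₂ o) ∩ (connEvent ends a₁ a₂)ᶜ) -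
                prob p (connEvent ends a₂ c ∩ (connEvent ends a₁ a₂)ᶜ) * prob p (connEvent ends a₁ u ∩ (connEvent ends a₁ o ∪ connEvent ends a₂ o) ∩ (connEvent ends a₁ a₂)ᶜ)) -
            prob p ((connEvent ends a₁ o ∪ connEvent ends a₂ o) ∩ (connEvent ends a₁ a₂)ᶜ) *
              (prob p (connEvent ends a₁ a₂)ᶜ * prob p (connEvent ends a₂ c ∩ connEvent ends a₁ u ∩ (connEvent ends a₁ a₂)ᶜ) -
                prob p (connEvent ends a₂ c ∩ (connEvent ends a₁ a₂)ᶜ) * prob p (connEvent ends a₁ u ∩ (connEvent ends a₁ a₂)ᶜ)) -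
            prob p (connEvent ends a₁ a₂)ᶜ *
              (prob p (connEvent ends a₁ a₂)ᶜ * prob p (connEvent ends a₂ c ∩ connEvent ends a₁ o ∩ (connEvent ends a₁ a₂)ᶜ) -
                prob p (connEvent ends a₂ c ∩ (connEvent ends a₁ a₂)ᶜ) * prob p (connEvent ends a₁ o ∩ (connEvent ends a₁ a₂)ᶜ)) +
            (prob p ((connEvent ends a₁ u ∪ connEvent ends a₂ u) ∩ (connEvent ends a₁ a₂)ᶜ) - prob p (connEvent ends a₁ a₂)ᶜ) *
              (prob p (connEvent ends a₁ a₂)ᶜ * prob p (connEvent ends a₁ c ∩ connEvent ends a₂ o ∩ (connEvent ends a₁ a₂)ᶜ) - prob p (connEvent ends a₁ c ∩ (connEvent ends a₁ a₂)ᶜ) * prob p (connEvent ends a₂ o ∩ (connEvent ends a₁ a₂)ᶜ) +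
                prob p (connEvent ends a₁ a₂)ᶜ * prob p (connEvent ends a₂ c ∩ connEvent ends a₁ o ∩ (connEvent ends a₁ a₂)ᶜ) - prob p (connEvent ends a₂ c ∩ (connEvent ends a₁ a₂)ᶜ) * prob p (connEvent ends a₁ o ∩ (connEvent ends a₁ a₂)ᶜ))) := by
  classical
  have hc₁ : c ∈ V₁ := hs.a₁_mem.1
  have det : ∀ {x y : V}, x ∈ V₁ → y ∈ V₁ → ∀ ω, ω ∈ connEvent ends x y ↔
      restrictTo (side₁ ends V₁) ω ∈ connEvent ends x y :=
    fun hx hy ω => conn_detour hs (ω := ω) hx hy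
  have dD : ∀ ω, ω ∈ (connEvent ends a₁ a₂)ᶜ ↔
      restrictTo (side₁ ends V₁) ω ∈ (connEvent ends a₁ a₂)ᶜ := fun ω => by
    have := det ha₁ ha₂ ω
    simp only [Set.mem_compl_iff]
    tauto
  have dand : ∀ {X Y : Set (Config E)}, (∀ ω, ω ∈ X ↔ restrictTo (side₁ ends V₁) ω ∈ X) →
      (∀ ω, ω ∈ Y ↔ restrictTo (side₁ ends V₁) ω ∈ Y) →
      ∀ ω, ω ∈ X ∩ Y ↔ restrictTo (side₁ ends V₁) ω ∈ X ∩ Y := fun hX hY ω => by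
    have := hX ω; have := hY ω
    simp only [Set.mem_inter_iff]
    tauto
  have dor : ∀ {X Y : Set (Config E)}, (∀ ω, ω ∈ X ↔ restrictTo (side₁ ends V₁) ω ∈ X) →
      (∀ ω, ω ∈ Y ↔ restrictTo (side₁ ends V₁) ω ∈ Y) →
      ∀ ω, ω ∈ X ∪ Y ↔ restrictTo (side₁ ends V₁) ω ∈ X ∪ Y := fun hX hY ω => by
    have := hX ω; have := hY ω
    simp only [Set.mem_union]
    tauto
  set D := (connEvent ends a₁ a₂)ᶜ with hDdef
  set Lb := connEvent ends a₁ b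
  set Hb := connEvent ends a₂ b
  set Lu := connEvent ends a₁ u
  set Hu := connEvent ends a₂ u
  set Lo := connEvent ends a₁ o
  set Ho := connEvent ends a₂ o
  set Lc := connEvent ends a₁ c
  set Hc := connEvent ends a₂ c
  have dHu := det ha₂ hu
  have dLu := det ha₁ hu
  have doU := dor (det ha₁ ho) (det ha₂ ho)
  have dHo := det ha₂ ho
  have dLo := det ha₁ ho
  have F1 := prob_pendant_mul p hs ha₁ hb (Y := connEvent ends a₂ u ∩ (connEvent ends a₁ o ∪ connEvent ends a₂ o) ∩ (connEvent ends a₁ a₂)ᶜ) (dand (dand dHu doU) dD)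
  have F2 := prob_pendant_mul p hs ha₁ hb (Y := (connEvent ends a₁ a₂)ᶜ) dD
  have F3 := prob_pendant_mul p hs ha₁ hb (Y := connEvent ends a₂ u ∩ (connEvent ends a₁ a₂)ᶜ) (dand dHu dD)
  have F4 := prob_pendant_mul p hs ha₁ hb (Y := connEvent ends a₂ o ∩ (connEvent ends a₁ a₂)ᶜ) (dand dHo dD)
  have G1 := prob_pendant_mul p (a₁ := a₂) hs ha₂ hb (Y := connEvent ends a₁ u ∩ (connEvent ends a₁ o ∪ connEvent ends a₂ o) ∩ (connEvent ends a₁ a₂)ᶜ) (dand (dand dLu doU) dD)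
  have G2 := prob_pendant_mul p (a₁ := a₂) hs ha₂ hb (Y := (connEvent ends a₁ a₂)ᶜ) dD
  have G3 := prob_pendant_mul p (a₁ := a₂) hs ha₂ hb (Y := connEvent ends a₁ u ∩ (connEvent ends a₁ a₂)ᶜ) (dand dLu dD)
  have G4 := prob_pendant_mul p (a₁ := a₂) hs ha₂ hb (Y := connEvent ends a₁ o ∩ (connEvent ends a₁ a₂)ᶜ) (dand dLo dD)
  have a1 : Lb ∩ Hu ∩ (Lo ∪ Ho) ∩ D = Lb ∩ (Hu ∩ (Lo ∪ Ho) ∩ D) := by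
    ext ω; simp only [Set.mem_inter_iff, Set.mem_union]; tauto
  have a3 : Lb ∩ Hu ∩ D = Lb ∩ (Hu ∩ D) := by
    ext ω; simp only [Set.mem_inter_iff]; tauto
  have a4 : Lb ∩ Ho ∩ D = Lb ∩ (Ho ∩ D) := by
    ext ω; simp only [Set.mem_inter_iff]; tauto
  have b1 : Hb ∩ Lu ∩ (Lo ∪ Ho) ∩ D = Hb ∩ (Lu ∩ (Lo ∪ Ho) ∩ D) := by
    ext ω; simp only [Set.mem_inter_iff, Set.mem_union]; tauto
  have b3 : Hb ∩ Lu ∩ D = Hb ∩ (Lu ∩ D) := by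
    ext ω; simp only [Set.mem_inter_iff]; tauto
  have b4 : Hb ∩ Lo ∩ D = Hb ∩ (Lo ∩ D) := by
    ext ω; simp only [Set.mem_inter_iff]; tauto
  have c1 : Lc ∩ (Hu ∩ (Lo ∪ Ho) ∩ D) = Lc ∩ Hu ∩ (Lo ∪ Ho) ∩ D := by
    ext ω; simp only [Set.mem_inter_iff, Set.mem_union]; tauto
  have c3 : Lc ∩ (Hu ∩ D) = Lc ∩ Hu ∩ D := by
    ext ω; simp only [Set.mem_inter_iff]; tauto
  have c4 : Lc ∩ (Ho ∩ D) = Lc ∩ Ho ∩ D := by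
    ext ω; simp only [Set.mem_inter_iff]; tauto
  have d1 : Hc ∩ (Lu ∩ (Lo ∪ Ho) ∩ D) = Hc ∩ Lu ∩ (Lo ∪ Ho) ∩ D := by
    ext ω; simp only [Set.mem_inter_iff, Set.mem_union]; tauto
  have d3 : Hc ∩ (Lu ∩ D) = Hc ∩ Lu ∩ D := by
    ext ω; simp only [Set.mem_inter_iff]; tauto
  have d4 : Hc ∩ (Lo ∩ D) = Hc ∩ Lo ∩ D := by
    ext ω; simp only [Set.mem_inter_iff]; tauto
  rw [a1, a3, a4, b1, b3, b4, F1, F2, F3, F4, G1, G2, G3, G4, c1, c3, c4, d1, d3, d4]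
  ring

/-- **Pendant `o`, typed.**  `β₁(o, u, b) = P(γ_o) · β₁(c, u, b)`. -/
theorem beta1_pendant_o (p : E → R) {ends : E → Sym2 V} {c a₁ a₂ : V} {V₁ V₂ : Set V}
    (hs : IsRootPairSep ends c c V₁ V₂) [DecidablePred (· ∈ side₁ ends V₁)]
    [DecidablePred (· ∈ (side₁ ends V₁)ᶜ)] (ha₁ : a₁ ∈ V₁) (ha₂ : a₂ ∈ V₁) {o u b : V}
    (ho : o ∈ V₂) (hu : u ∈ V₁) (hb : b ∈ V₁) :
    prob p (connEvent ends a₁ a₂)ᶜ *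
          (prob p (connEvent ends a₁ a₂)ᶜ * prob p (connEvent ends a₁ b ∩ connEvent ends a₂ u ∩ (connEvent ends a₁ o ∪ connEvent ends a₂ o) ∩ (connEvent ends a₁ a₂)ᶜ) -
            prob p (connEvent ends a₁ b ∩ (connEvent ends a₁ a₂)ᶜ) * prob p (connEvent ends a₂ u ∩ (connEvent ends a₁ o ∪ connEvent ends a₂ o) ∩ (connEvent ends a₁ a₂)ᶜ)) -
        prob p ((connEvent ends a₁ o ∪ connEvent ends a₂ o) ∩ (connEvent ends a₁ a₂)ᶜ) *
          (prob p (connEvent ends a₁ a₂)ᶜ * prob p (connEvent ends a₁ b ∩ connEvent ends a₂ u ∩ (connEvent ends a₁ a₂)ᶜ) -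
            prob p (connEvent ends a₁ b ∩ (connEvent ends a₁ a₂)ᶜ) * prob p (connEvent ends a₂ u ∩ (connEvent ends a₁ a₂)ᶜ)) -
        prob p (connEvent ends a₁ a₂)ᶜ *
          (prob p (connEvent ends a₁ a₂)ᶜ * prob p (connEvent ends a₁ b ∩ connEvent ends a₂ o ∩ (connEvent ends a₁ a₂)ᶜ) -
            prob p (connEvent ends a₁ b ∩ (connEvent ends a₁ a₂)ᶜ) * prob p (connEvent ends a₂ o ∩ (connEvent ends a₁ a₂)ᶜ)) +
        prob p (connEvent ends a₁ a₂)ᶜ *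
          (prob p (connEvent ends a₁ a₂)ᶜ * prob p (connEvent ends a₂ b ∩ connEvent ends a₁ u ∩ (connEvent ends a₁ o ∪ connEvent ends a₂ o) ∩ (connEvent ends a₁ a₂)ᶜ) -
            prob p (connEvent ends a₂ b ∩ (connEvent ends a₁ a₂)ᶜ) * prob p (connEvent ends a₁ u ∩ (connEvent ends a₁ o ∪ connEvent ends a₂ o) ∩ (connEvent ends a₁ a₂)ᶜ)) -
        prob p ((connEvent ends a₁ o ∪ connEvent ends a₂ o) ∩ (connEvent ends a₁ a₂)ᶜ) *
          (prob p (connEvent ends a₁ a₂)ᶜ * prob p (connEvent ends a₂ b ∩ connEvent ends a₁ u ∩ (connEvent ends a₁ a₂)ᶜ) -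
            prob p (connEvent ends a₂ b ∩ (connEvent ends a₁ a₂)ᶜ) * prob p (connEvent ends a₁ u ∩ (connEvent ends a₁ a₂)ᶜ)) -
        prob p (connEvent ends a₁ a₂)ᶜ *
          (prob p (connEvent ends a₁ a₂)ᶜ * prob p (connEvent ends a₂ b ∩ connEvent ends a₁ o ∩ (connEvent ends a₁ a₂)ᶜ) -
            prob p (connEvent ends a₂ b ∩ (connEvent ends a₁ a₂)ᶜ) * prob p (connEvent ends a₁ o ∩ (connEvent ends a₁ a₂)ᶜ)) +
        (prob p ((connEvent ends a₁ u ∪ connEvent ends a₂ u) ∩ (connEvent ends a₁ a₂)ᶜ) - prob p (connEvent ends a₁ a₂)ᶜ) *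
          (prob p (connEvent ends a₁ a₂)ᶜ * prob p (connEvent ends a₁ b ∩ connEvent ends a₂ o ∩ (connEvent ends a₁ a₂)ᶜ) - prob p (connEvent ends a₁ b ∩ (connEvent ends a₁ a₂)ᶜ) * prob p (connEvent ends a₂ o ∩ (connEvent ends a₁ a₂)ᶜ) +
            prob p (connEvent ends a₁ a₂)ᶜ * prob p (connEvent ends a₂ b ∩ connEvent ends a₁ o ∩ (connEvent ends a₁ a₂)ᶜ) - prob p (connEvent ends a₂ b ∩ (connEvent ends a₁ a₂)ᶜ) * prob p (connEvent ends a₁ o ∩ (connEvent ends a₁ a₂)ᶜ)) =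
      prob p (restrictTo (side₁ ends V₁)ᶜ ⁻¹' connEvent ends o c) *
       (        prob p (connEvent ends a₁ a₂)ᶜ *
              (prob p (connEvent ends a₁ a₂)ᶜ * prob p (connEvent ends a₁ b ∩ connEvent ends a₂ u ∩ (connEvent ends a₁ c ∪ connEvent ends a₂ c) ∩ (connEvent ends a₁ a₂)ᶜ) -
                prob p (connEvent ends a₁ b ∩ (connEvent ends a₁ a₂)ᶜ) * prob p (connEvent ends a₂ u ∩ (connEvent ends a₁ c ∪ connEvent ends a₂ c) ∩ (connEvent ends a₁ a₂)ᶜ)) -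
            prob p ((connEvent ends a₁ c ∪ connEvent ends a₂ c) ∩ (connEvent ends a₁ a₂)ᶜ) *
              (prob p (connEvent ends a₁ a₂)ᶜ * prob p (connEvent ends a₁ b ∩ connEvent ends a₂ u ∩ (connEvent ends a₁ a₂)ᶜ) -
                prob p (connEvent ends a₁ b ∩ (connEvent ends a₁ a₂)ᶜ) * prob p (connEvent ends a₂ u ∩ (connEvent ends a₁ a₂)ᶜ)) -
            prob p (connEvent ends a₁ a₂)ᶜ *
              (prob p (connEvent ends a₁ a₂)ᶜ * prob p (connEvent ends a₁ b ∩ connEvent ends a₂ c ∩ (connEvent ends a₁ a₂)ᶜ) -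
                prob p (connEvent ends a₁ b ∩ (connEvent ends a₁ a₂)ᶜ) * prob p (connEvent ends a₂ c ∩ (connEvent ends a₁ a₂)ᶜ)) +
            prob p (connEvent ends a₁ a₂)ᶜ *
              (prob p (connEvent ends a₁ a₂)ᶜ * prob p (connEvent ends a₂ b ∩ connEvent ends a₁ u ∩ (connEvent ends a₁ c ∪ connEvent ends a₂ c) ∩ (connEvent ends a₁ a₂)ᶜ) -
                prob p (connEvent ends a₂ b ∩ (connEvent ends a₁ a₂)ᶜ) * prob p (connEvent ends a₁ u ∩ (connEvent ends a₁ c ∪ connEvent ends a₂ c) ∩ (connEvent ends a₁ a₂)ᶜ)) -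
            prob p ((connEvent ends a₁ c ∪ connEvent ends a₂ c) ∩ (connEvent ends a₁ a₂)ᶜ) *
              (prob p (connEvent ends a₁ a₂)ᶜ * prob p (connEvent ends a₂ b ∩ connEvent ends a₁ u ∩ (connEvent ends a₁ a₂)ᶜ) -
                prob p (connEvent ends a₂ b ∩ (connEvent ends a₁ a₂)ᶜ) * prob p (connEvent ends a₁ u ∩ (connEvent ends a₁ a₂)ᶜ)) -
            prob p (connEvent ends a₁ a₂)ᶜ *
              (prob p (connEvent ends a₁ a₂)ᶜ * prob p (connEvent ends a₂ b ∩ connEvent ends a₁ c ∩ (connEvent ends a₁ a₂)ᶜ) -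
                prob p (connEvent ends a₂ b ∩ (connEvent ends a₁ a₂)ᶜ) * prob p (connEvent ends a₁ c ∩ (connEvent ends a₁ a₂)ᶜ)) +
            (prob p ((connEvent ends a₁ u ∪ connEvent ends a₂ u) ∩ (connEvent ends a₁ a₂)ᶜ) - prob p (connEvent ends a₁ a₂)ᶜ) *
              (prob p (connEvent ends a₁ a₂)ᶜ * prob p (connEvent ends a₁ b ∩ connEvent ends a₂ c ∩ (connEvent ends a₁ a₂)ᶜ) - prob p (connEvent ends a₁ b ∩ (connEvent ends a₁ a₂)ᶜ) * prob p (connEvent ends a₂ c ∩ (connEvent ends a₁ a₂)ᶜ) +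
                prob p (connEvent ends a₁ a₂)ᶜ * prob p (connEvent ends a₂ b ∩ connEvent ends a₁ c ∩ (connEvent ends a₁ a₂)ᶜ) - prob p (connEvent ends a₂ b ∩ (connEvent ends a₁ a₂)ᶜ) * prob p (connEvent ends a₁ c ∩ (connEvent ends a₁ a₂)ᶜ))) := by
  classical
  have hc₁ : c ∈ V₁ := hs.a₁_mem.1
  have det : ∀ {x y : V}, x ∈ V₁ → y ∈ V₁ → ∀ ω, ω ∈ connEvent ends x y ↔
      restrictTo (side₁ ends V₁) ω ∈ connEvent ends x y :=
    fun hx hy ω => conn_detour hs (ω := ω) hx hy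
  have dD : ∀ ω, ω ∈ (connEvent ends a₁ a₂)ᶜ ↔
      restrictTo (side₁ ends V₁) ω ∈ (connEvent ends a₁ a₂)ᶜ := fun ω => by
    have := det ha₁ ha₂ ω
    simp only [Set.mem_compl_iff]
    tauto
  have dand : ∀ {X Y : Set (Config E)}, (∀ ω, ω ∈ X ↔ restrictTo (side₁ ends V₁) ω ∈ X) →
      (∀ ω, ω ∈ Y ↔ restrictTo (side₁ ends V₁) ω ∈ Y) →
      ∀ ω, ω ∈ X ∩ Y ↔ restrictTo (side₁ ends V₁) ω ∈ X ∩ Y := fun hX hY ω => by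
    have := hX ω; have := hY ω
    simp only [Set.mem_inter_iff]
    tauto
  have dor : ∀ {X Y : Set (Config E)}, (∀ ω, ω ∈ X ↔ restrictTo (side₁ ends V₁) ω ∈ X) →
      (∀ ω, ω ∈ Y ↔ restrictTo (side₁ ends V₁) ω ∈ Y) →
      ∀ ω, ω ∈ X ∪ Y ↔ restrictTo (side₁ ends V₁) ω ∈ X ∪ Y := fun hX hY ω => by
    have := hX ω; have := hY ω
    simp only [Set.mem_union]
    tauto
  set D := (connEvent ends a₁ a₂)ᶜ with hDdef
  set Lb := connEvent ends a₁ b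
  set Hb := connEvent ends a₂ b
  set Lu := connEvent ends a₁ u
  set Hu := connEvent ends a₂ u
  set Lo := connEvent ends a₁ o
  set Ho := connEvent ends a₂ o
  set Lc := connEvent ends a₁ c
  set Hc := connEvent ends a₂ c
  have dLb := det ha₁ hb
  have dHb := det ha₂ hb
  have dHu := det ha₂ hu
  have dLu := det ha₁ hu
  have U1 := prob_pendant_union_mul p hs ha₁ ha₂ ho (Y := connEvent ends a₁ b ∩ connEvent ends a₂ u ∩ (connEvent ends a₁ a₂)ᶜ) (dand (dand dLb dHu) dD)
  have U2 := prob_pendant_union_mul p hs ha₁ ha₂ ho (Y := connEvent ends a₂ u ∩ (connEvent ends a₁ a₂)ᶜ) (dand dHu dD)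
  have U3 := prob_pendant_union_mul p hs ha₁ ha₂ ho (Y := (connEvent ends a₁ a₂)ᶜ) dD
  have U4 := prob_pendant_union_mul p hs ha₁ ha₂ ho (Y := connEvent ends a₂ b ∩ connEvent ends a₁ u ∩ (connEvent ends a₁ a₂)ᶜ) (dand (dand dHb dLu) dD)
  have U5 := prob_pendant_union_mul p hs ha₁ ha₂ ho (Y := connEvent ends a₁ u ∩ (connEvent ends a₁ a₂)ᶜ) (dand dLu dD)
  have G4 := prob_pendant_mul p (a₁ := a₂) hs ha₂ ho (Y := connEvent ends a₁ b ∩ (connEvent ends a₁ a₂)ᶜ) (dand dLb dD)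
  have G5 := prob_pendant_mul p (a₁ := a₂) hs ha₂ ho (Y := (connEvent ends a₁ a₂)ᶜ) dD
  have F4 := prob_pendant_mul p hs ha₁ ho (Y := connEvent ends a₂ b ∩ (connEvent ends a₁ a₂)ᶜ) (dand dHb dD)
  have F5 := prob_pendant_mul p hs ha₁ ho (Y := (connEvent ends a₁ a₂)ᶜ) dD
  have a1 : Lb ∩ Hu ∩ (Lo ∪ Ho) ∩ D = (Lo ∪ Ho) ∩ (Lb ∩ Hu ∩ D) := by
    ext ω; simp only [Set.mem_inter_iff, Set.mem_union]; tauto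
  have a2 : Hu ∩ (Lo ∪ Ho) ∩ D = (Lo ∪ Ho) ∩ (Hu ∩ D) := by
    ext ω; simp only [Set.mem_inter_iff, Set.mem_union]; tauto
  have a3 : Lb ∩ Ho ∩ D = Ho ∩ (Lb ∩ D) := by
    ext ω; simp only [Set.mem_inter_iff]; tauto
  have b1 : Hb ∩ Lu ∩ (Lo ∪ Ho) ∩ D = (Lo ∪ Ho) ∩ (Hb ∩ Lu ∩ D) := by
    ext ω; simp only [Set.mem_inter_iff, Set.mem_union]; tauto
  have b2 : Lu ∩ (Lo ∪ Ho) ∩ D = (Lo ∪ Ho) ∩ (Lu ∩ D) := by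
    ext ω; simp only [Set.mem_inter_iff, Set.mem_union]; tauto
  have b3 : Hb ∩ Lo ∩ D = Lo ∩ (Hb ∩ D) := by
    ext ω; simp only [Set.mem_inter_iff]; tauto
  have c1 : (Lc ∪ Hc) ∩ (Lb ∩ Hu ∩ D) = Lb ∩ Hu ∩ (Lc ∪ Hc) ∩ D := by
    ext ω; simp only [Set.mem_inter_iff, Set.mem_union]; tauto
  have c2 : (Lc ∪ Hc) ∩ (Hu ∩ D) = Hu ∩ (Lc ∪ Hc) ∩ D := by
    ext ω; simp only [Set.mem_inter_iff, Set.mem_union]; tauto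
  have c3 : Hc ∩ (Lb ∩ D) = Lb ∩ Hc ∩ D := by
    ext ω; simp only [Set.mem_inter_iff]; tauto
  have d1 : (Lc ∪ Hc) ∩ (Hb ∩ Lu ∩ D) = Hb ∩ Lu ∩ (Lc ∪ Hc) ∩ D := by
    ext ω; simp only [Set.mem_inter_iff, Set.mem_union]; tauto
  have d2 : (Lc ∪ Hc) ∩ (Lu ∩ D) = Lu ∩ (Lc ∪ Hc) ∩ D := by
    ext ω; simp only [Set.mem_inter_iff, Set.mem_union]; tauto
  have d3 : Lc ∩ (Hb ∩ D) = Hb ∩ Lc ∩ D := by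
    ext ω; simp only [Set.mem_inter_iff]; tauto
  rw [a1, a2, a3, b1, b2, b3, U1, U2, U3, U4, U5, G4, G5, F4, F5, c1, c2, c3, d1, d2, d3]
  ring

end Main

end RootPairSep

end Summit.Ventures.PercRepro2
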